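/-
Copyright (c) 2026 the pub-hodgecm-mathlib formalisation cell (harness21).  Prover seat hodgecm-mathlib-A-p03 (g24), road «N6-ns»
(the non-split clause of letter N6), brick «N6ns-reg-(ii′) HC UNIFORM COMPACTNESS, NON-ARCH» (LEAD F0P3a-plan (g9) WORDS T8-12 (B) ∕ T8-16 (B)(1), 2026-09-01).
-/
import Literature.NumberTheory.Automorphic.ArchLocalRegularOrbitClosed   -- ★ field ∕ `U(σ,J)` closed classes, square roots near `1`, ★ `ConjClassClosedEmbedding`
import Literature.NumberTheory.Automorphic.UnitaryGroupOfFormAdelicTopology   -- ★ `isClosed_unitaryGroupOfForm`, `locallyCompactSpace_unitaryGroupOfForm`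
import HarnessLib

/-!
# Conjugation is proper on regular compacta (Harish-Chandra's uniform compactness lemma, non-archimedean form)

Topic `NumberTheory/Automorphic`; namespace `Literature.NumberTheory.Automorphic`.  THEOREMS ONLY (no definition, no instance, no notation,
no named fact, no `sorry`).  Cell `pub/hodgecm-mathlib`, ENGINE T1 (crux H413 = `stmt-HodgeConjecture-24833`), road «N6-ns», brick (ii′): the
input «for compact `K ⊆ T_reg` and compact `C ⊆ G` the set `{ẋ ∈ G ⧸ T ∣ ∃ t ∈ K, x t x⁻¹ ∈ C}` is compact» of the local constancy ∕ smoothness of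
regular orbital integrals for test functions NOT supported in one chart image (consumers: ★ `OrbitalIntegralLocallyConstantChart` and its unitary dress,
the H-side surjectivity (iv), the glue (iii)) [HarishChandra1970, Part I §3; Rogawski1990 §4.9; DeitmarEchterhoff2014 Lemma 9.3.3].

THE MATHEMATICS («straightening»: the uniformity in `t ∈ K` REDUCES to the ★ single-element properness).  The SINGLE-ELEMENT statement is in the
tree: for a σ-compact locally compact group and a CLOSED conjugacy class the orbit map `G ⧸ Z(γ) → G` is a closed embedding, so
`{ẋ ∣ x γ x⁻¹ ∈ D}` is compact for compact `D` (★ `Literature.MeasureTheory.Group.isCompact_preimage_descConj_id_of_isClosed`, Baire open mapping;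
regular semisimple classes are closed: ★ `isClosed_conjClass_of_charpoly_separable_field`, ★ `isClosed_conjClass_unitaryGroupOfForm_of_isClosed`).
Now let `γ ∈ GL_m(F)` be regular semisimple (separable characteristic polynomial), `T = Z(γ) = F[γ]ˣ`, `K ⊆ T` compact with every `t ∈ K` regular,
`C` compact.  For `t ∈ K`: `t ∈ F[γ]` (★ `exists_eq_aeval_of_commute_of_minpoly_eq_charpoly`) and `t` regular give `F[t] = F[γ]`, so `γ = P_t(t)` for a
unique polynomial `P_t` of degree `< m`; its coefficient vector is `a(t) = M(t)⁻¹ · R · vec γ`, where `V(t)` is the `m² × m` matrix of the flattened powers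
`t^k` (polynomial in `t`), `R` is a fixed left inverse of `V(γ)` and `M(t) = R V(t)` is invertible exactly when `t` is regular — so `a` is CONTINUOUS on
the regular part of `F[γ]` (adjugate and `det⁻¹`).  The map `p(t, c) = Σ_k a_k(t) c^k` is then continuous on `K × C` with `p(t, x t x⁻¹) = x γ x⁻¹`, whence
`{x ∣ ∃ t ∈ K, x t x⁻¹ ∈ C} ⊆ {x ∣ x γ x⁻¹ ∈ D}` for the COMPACT `D = p(K × C) ∩ {charpoly = charpoly γ}`: the `K`-uniform set sits inside ONE
single-element set, compact by ★.  It is closed (tube lemma over the compact `K`) and `T`-saturated, hence compact.  No charts, no Weyl group, no sequences.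

* §1 generic topological groups: `isClosed_setOf_exists_conj_mem` (tube lemma), `setOf_exists_conj_mem_mul_eq` (`T`-saturation),
  **`exists_isCompact_image_mk_setOf_exists_conj_mem_subset`** (ONE compact `E ⊆ G ⧸ T` from a «straightening» into a compact `D`),
  **`isCompact_image_mk_setOf_exists_conj_mem`**, `support_descConj_subset_of_subset` (every orbital integrand `ẋ ↦ f(x t x⁻¹)`, `t ∈ K`, is supported in `E`);
* §2 the straightening over a topological field: **`exists_continuousOn_sum_smul_pow_eq_of_charpoly_separable`**;
* §3 `GL_m(F)`: `commute_of_commute_of_charpoly_separable` (the commutant of a regular semisimple matrix is commutative),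
  **`GL.exists_isCompact_forall_conj_mem_of_charpoly_separable`** (the compact `D`), **`GL.isCompact_image_mk_setOf_exists_conj_mem_of_charpoly_separable`**,
  `GL.exists_isCompact_forall_support_descConj_subset_of_charpoly_separable`;
* §4 `U(σ, J)(E) ≤ GL_m(E)` over a complete field (A-p16's chart-3 currency): **`UnitaryGroupOfForm.isCompact_image_mk_setOf_exists_conj_mem_of_charpoly_separable`**,
  `UnitaryGroupOfForm.exists_isCompact_forall_support_descConj_subset_of_charpoly_separable`.
NOT HERE: the charts (★ `RegularOrbitChart*`), the local constancy itself (★ `OrbitalIntegralLocallyConstant*`), singular `t`, the `(cmDatum L N H).Local v`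
dress (a transport through ★ `localNonsplitEquiv`, on a consumer's word).  HONEST LABEL: HC_CM is proved only modulo the printed citations until rung 0
closes; this file is topology ∕ linear algebra and pays nothing by itself.

## References
* [HarishChandra1970] Harish-Chandra (notes by G. van Dijk), *Harmonic Analysis on Reductive p-adic Groups*, LNM 162 (1970), Part I §3, Lemmas 13–14
  (the map `G ⧸ A × A′ → G` and the compactness of `{ẋ ∣ x K x⁻¹ ∩ C ≠ ∅}`).
* [Rogawski1990] J. D. Rogawski, *Automorphic Representations of Unitary Groups in Three Variables*, Ann. of Math. Stud. 123 (1990), §4.9 p. 54, §3.1 p. 19.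
* [DeitmarEchterhoff2014] A. Deitmar, S. Echterhoff, *Principles of Harmonic Analysis*, 2nd ed. (2014), Lemma 9.3.3 (closed orbits ⇒ proper orbit maps).
* [HornJohnson2013] R. A. Horn, C. R. Johnson, *Matrix Analysis*, 2nd ed. (2013), Thm. 3.2.4.2 (the commutant of a nonderogatory matrix is `F[A]`).
-/

set_option autoImplicit false

noncomputable section

open Set Filter Topology Polynomial
open Literature.MeasureTheory.Group Literature.LinearAlgebra.Matrix
open scoped Matrix MatrixGroups Pointwise

namespace Literature.NumberTheory.Automorphic

/-! ## §1 Generic topological groups -/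

section Generic

variable {G : Type*} [Group G] [TopologicalSpace G] [IsTopologicalGroup G]

/-- **Tube lemma form**: for compact `K` and closed `C`, `{x ∣ ∃ t ∈ K, x t x⁻¹ ∈ C}` is closed (it is the projection along the compact factor
`K` of the closed set `{(x, t) ∣ x t x⁻¹ ∈ C}`). [cite: HarishChandra1970, Part I §3 Lemma 14] -/
theorem isClosed_setOf_exists_conj_mem {K C : Set G} (hK : IsCompact K) (hC : IsClosed C) :
    IsClosed {x : G | ∃ t ∈ K, x * t * x⁻¹ ∈ C} := by
  haveI : CompactSpace K := isCompact_iff_compactSpace.1 hK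
  have hZ : IsClosed {p : G × K | p.1 * (p.2 : G) * p.1⁻¹ ∈ C} :=
    hC.preimage ((continuous_fst.mul (continuous_subtype_val.comp continuous_snd)).mul continuous_fst.inv)
  have himg : Prod.fst '' {p : G × K | p.1 * (p.2 : G) * p.1⁻¹ ∈ C} = {x : G | ∃ t ∈ K, x * t * x⁻¹ ∈ C} := by
    ext x
    simp only [mem_image, mem_setOf_eq, Prod.exists, Subtype.exists, exists_and_right, exists_eq_right]
    constructor
    · rintro ⟨t, ht, h⟩; exact ⟨t, ht, h⟩
    · rintro ⟨t, ht, h⟩; exact ⟨t, ht, h⟩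
  rw [← himg]
  exact isClosedMap_fst_of_compactSpace _ hZ

omit [TopologicalSpace G] [IsTopologicalGroup G] in
/-- **`T`-saturation**: if `T` centralises `K` then `{x ∣ ∃ t ∈ K, x t x⁻¹ ∈ C} · T = {x ∣ ∃ t ∈ K, x t x⁻¹ ∈ C}` (`(xτ) t (xτ)⁻¹ = x t x⁻¹`).
[cite: HarishChandra1970, Part I §3 Lemma 14] -/
theorem setOf_exists_conj_mem_mul_eq (T : Subgroup G) {K C : Set G} (hKT : ∀ t ∈ K, ∀ τ ∈ T, τ * t = t * τ) :
    {x : G | ∃ t ∈ K, x * t * x⁻¹ ∈ C} * (T : Set G) = {x : G | ∃ t ∈ K, x * t * x⁻¹ ∈ C} := by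
  ext y
  constructor
  · rintro ⟨x, ⟨t, ht, hx⟩, τ, hτ, rfl⟩
    refine ⟨t, ht, ?_⟩
    have h : x * τ * t * (x * τ)⁻¹ = x * t * x⁻¹ := by
      rw [mul_inv_rev, mul_assoc x τ t, hKT t ht τ hτ, ← mul_assoc]
      simp only [mul_assoc, mul_inv_cancel_left]
    simpa only [h] using hx
  · intro hy
    exact ⟨y, hy, 1, T.one_mem, mul_one y⟩

/-- The image of `{x ∣ ∃ t ∈ K, x t x⁻¹ ∈ C}` in `G ⧸ T` is closed for compact `K` centralised by `T` and closed `C`.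
[cite: HarishChandra1970, Part I §3 Lemma 14] -/
theorem isClosed_image_mk_setOf_exists_conj_mem (T : Subgroup G) {K C : Set G} (hK : IsCompact K) (hC : IsClosed C)
    (hKT : ∀ t ∈ K, ∀ τ ∈ T, τ * t = t * τ) :
    IsClosed ((QuotientGroup.mk : G → G ⧸ T) '' {x : G | ∃ t ∈ K, x * t * x⁻¹ ∈ C}) := by
  rw [← (QuotientGroup.isQuotientMap_mk T).isClosed_preimage, QuotientGroup.preimage_image_mk_eq_mul,
    setOf_exists_conj_mem_mul_eq T hKT]
  exact isClosed_setOf_exists_conj_mem hK hC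

omit [IsTopologicalGroup G] in
/-- **ONE compact set of `G ⧸ T` from a straightening.**  Let `T` centralise `γ` and suppose the single-element orbit map
`ẋ ↦ x γ x⁻¹ : G ⧸ T → G` pulls compacta back to compacta (★ `isCompact_preimage_descConj_id_of_isClosed`: closed class in a σ-compact locally
compact group).  If every conjugate `x t x⁻¹ ∈ C`, `t ∈ K`, forces `x γ x⁻¹ ∈ D` for ONE compact `D` («straightening»), then all of
`{ẋ ∣ ∃ t ∈ K, x t x⁻¹ ∈ C}` lies in the compact `E = {ẋ ∣ x γ x⁻¹ ∈ D}`. [cite: HarishChandra1970, Part I §3 Lemmas 13–14]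
[cite: DeitmarEchterhoff2014, Lemma 9.3.3] -/
theorem exists_isCompact_image_mk_setOf_exists_conj_mem_subset (T : Subgroup G) (γ : G) (hT : ∀ τ ∈ T, τ * γ = γ * τ)
    (hprop : ∀ D : Set G, IsCompact D → IsCompact (descConj γ T hT id ⁻¹' D)) {K C D : Set G} (hD : IsCompact D)
    (hstr : ∀ t ∈ K, ∀ x : G, x * t * x⁻¹ ∈ C → x * γ * x⁻¹ ∈ D) :
    ∃ E : Set (G ⧸ T), IsCompact E ∧ (QuotientGroup.mk : G → G ⧸ T) '' {x : G | ∃ t ∈ K, x * t * x⁻¹ ∈ C} ⊆ E := by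
  refine ⟨descConj γ T hT id ⁻¹' D, hprop D hD, ?_⟩
  rintro _ ⟨x, ⟨t, ht, hx⟩, rfl⟩
  exact hstr t ht x hx

/-- **Harish-Chandra's uniform compactness, abstract form**: under the hypotheses of
`exists_isCompact_image_mk_setOf_exists_conj_mem_subset`, with `K` compact and centralised by `T` and `C` closed, the set
`{ẋ ∈ G ⧸ T ∣ ∃ t ∈ K, x t x⁻¹ ∈ C}` is COMPACT. [cite: HarishChandra1970, Part I §3 Lemma 14] [cite: Rogawski1990, §4.9 p. 54] -/
theorem isCompact_image_mk_setOf_exists_conj_mem (T : Subgroup G) (γ : G) (hT : ∀ τ ∈ T, τ * γ = γ * τ)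
    (hprop : ∀ D : Set G, IsCompact D → IsCompact (descConj γ T hT id ⁻¹' D)) {K C D : Set G} (hK : IsCompact K)
    (hKT : ∀ t ∈ K, ∀ τ ∈ T, τ * t = t * τ) (hC : IsClosed C) (hD : IsCompact D)
    (hstr : ∀ t ∈ K, ∀ x : G, x * t * x⁻¹ ∈ C → x * γ * x⁻¹ ∈ D) :
    IsCompact ((QuotientGroup.mk : G → G ⧸ T) '' {x : G | ∃ t ∈ K, x * t * x⁻¹ ∈ C}) := by
  obtain ⟨E, hE, hsub⟩ := exists_isCompact_image_mk_setOf_exists_conj_mem_subset T γ hT hprop hD hstr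
  exact hE.of_isClosed_subset (isClosed_image_mk_setOf_exists_conj_mem T hK hC hKT) hsub

omit [TopologicalSpace G] [IsTopologicalGroup G] in
/-- **The consumer's reading**: if `{ẋ ∣ ∃ t ∈ K, x t x⁻¹ ∈ C}` lies in `E` and `f` is supported in `C`, then for EVERY `t ∈ K` the orbital
integrand `ẋ ↦ f(x t x⁻¹)` (★ `descConj t T _ f`) is supported in the one set `E`. [cite: Rogawski1990, §4.9 p. 54]
[cite: HarishChandra1970, Part I §3 Lemma 14] -/
theorem support_descConj_subset_of_subset (T : Subgroup G) {K C : Set G} {E : Set (G ⧸ T)}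
    (hKT : ∀ t ∈ K, ∀ τ ∈ T, τ * t = t * τ)
    (hsub : (QuotientGroup.mk : G → G ⧸ T) '' {x : G | ∃ t ∈ K, x * t * x⁻¹ ∈ C} ⊆ E)
    {β : Type*} [Zero β] {f : G → β} (hf : Function.support f ⊆ C) {t : G} (ht : t ∈ K) :
    Function.support (descConj t T (hKT t ht) f) ⊆ E := by
  intro q hq
  induction q using QuotientGroup.induction_on with
  | H x =>
    rw [Function.mem_support, descConj_mk] at hq
    exact hsub ⟨x, ⟨t, ht, hf hq⟩, rfl⟩

end Generic

/-! ## §2 The straightening over a topological field: `γ = Σ_k a_k(t) t^k` with `a` continuous on the regular part of `F[γ]` -/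

section Straighten

variable {F : Type*} [Field F] {m : ℕ}

/-- Every element of `F[γ] ⊆ M_m(F)` is an `F`-combination of `1, γ, …, γ^{m-1}` (Cayley–Hamilton reduction). [cite: HornJohnson2013, Thm. 3.2.4.2] -/
theorem exists_eq_sum_smul_pow_of_mem_adjoin (γ : Matrix (Fin m) (Fin m) F) {x : Matrix (Fin m) (Fin m) F}
    (hx : x ∈ Algebra.adjoin F ({γ} : Set (Matrix (Fin m) (Fin m) F))) :
    ∃ c : Fin m → F, x = ∑ k : Fin m, c k • γ ^ (k : ℕ) := by
  rcases Nat.eq_zero_or_pos m with hm | hm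
  · subst hm
    exact ⟨0, Subsingleton.elim _ _⟩
  rw [Algebra.adjoin_singleton_eq_range_aeval] at hx
  obtain ⟨q, rfl⟩ := hx
  have hmonic := Matrix.charpoly_monic γ
  have hne : γ.charpoly ≠ 1 := by
    intro h
    have := congrArg Polynomial.natDegree h
    rw [Matrix.charpoly_natDegree_eq_dim, Fintype.card_fin, natDegree_one] at this
    omega
  have hdeg : (q %ₘ γ.charpoly).natDegree < m := by
    have h := Polynomial.natDegree_modByMonic_lt q hmonic hne
    rwa [Matrix.charpoly_natDegree_eq_dim, Fintype.card_fin] at h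
  refine ⟨fun k => (q %ₘ γ.charpoly).coeff k, ?_⟩
  change aeval γ q = _
  rw [← Polynomial.aeval_modByMonic_eq_self_of_root (p := q) (Matrix.aeval_self_charpoly γ), aeval_eq_sum_range' hdeg,
    Fin.sum_univ_eq_sum_range (fun k => (q %ₘ γ.charpoly).coeff k • γ ^ k)]

/-- For `γ` with separable characteristic polynomial, every `t` commuting with `γ` has all its powers in the span of `1, γ, …, γ^{m-1}`:
`t^k = Σ_j Q_{jk} γ^j`. [cite: HornJohnson2013, Thm. 3.2.4.2] -/
theorem exists_pow_eq_sum_smul_pow_of_commute (γ : Matrix (Fin m) (Fin m) F) (hγ : γ.charpoly.Separable)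
    {t : Matrix (Fin m) (Fin m) F} (ht : Commute t γ) :
    ∃ Q : Matrix (Fin m) (Fin m) F, ∀ k : Fin m, t ^ (k : ℕ) = ∑ j : Fin m, Q j k • γ ^ (j : ℕ) := by
  obtain ⟨p, -, htp⟩ := exists_eq_aeval_of_commute_of_minpoly_eq_charpoly γ t (minpoly_eq_charpoly_of_charpoly_separable γ hγ) ht.symm
  have hmem : ∀ k : Fin m, t ^ (k : ℕ) ∈ Algebra.adjoin F ({γ} : Set (Matrix (Fin m) (Fin m) F)) := fun k => by
    rw [htp]
    exact Subalgebra.pow_mem _ (Polynomial.aeval_mem_adjoin_singleton F γ) _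
  choose c hc using fun k => exists_eq_sum_smul_pow_of_mem_adjoin γ (hmem k)
  exact ⟨Matrix.of fun j k => c k j, fun k => by simpa only [Matrix.of_apply] using hc k⟩

/-- Powers below the degree of the (separable) characteristic polynomial are linearly independent: `Σ_k c_k t^k = 0 ⇒ c = 0`.
[cite: HornJohnson2013, Thm. 3.2.4.2] -/
theorem eq_zero_of_sum_smul_pow_eq_zero (t : Matrix (Fin m) (Fin m) F) (ht : t.charpoly.Separable) {c : Fin m → F}
    (hc : ∑ k : Fin m, c k • t ^ (k : ℕ) = 0) : c = 0 := by
  have hdeg : (minpoly F t).natDegree = m := by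
    rw [minpoly_eq_charpoly_of_charpoly_separable t ht, Matrix.charpoly_natDegree_eq_dim, Fintype.card_fin]
  have hli : LinearIndependent F fun k : Fin m => t ^ (k : ℕ) := by
    exact (linearIndependent_pow (K := F) t).comp (finCongr hdeg.symm) (finCongr hdeg.symm).injective
  funext k
  exact Fintype.linearIndependent_iff.1 hli c hc k

variable [TopologicalSpace F] [IsTopologicalRing F] [ContinuousInv₀ F]

/-- **THE STRAIGHTENING.**  For `γ ∈ M_m(F)` with separable characteristic polynomial there is a coefficient map `a : M_m(F) → F^m`, CONTINUOUS on
the regular part `{t ∣ tγ = γt, χ_t separable}` of the commutant `F[γ]`, with `Σ_k a_k(t) t^k = γ` there: `γ` is the SAME continuous polynomial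
expression in every regular `t ∈ F[γ]`.  (`a(t) = M(t)⁻¹ R vec γ` with `M(t) = R V(t)`, `V(t)` the `m² × m` matrix of flattened powers of `t`, `R` a left
inverse of `V(γ)`; `M(t)` is invertible iff the powers of `t` are independent.) [cite: HarishChandra1970, Part I §3 Lemma 13] [cite: HornJohnson2013, Thm. 3.2.4.2] -/
theorem exists_continuousOn_sum_smul_pow_eq_of_charpoly_separable (γ : Matrix (Fin m) (Fin m) F) (hγ : γ.charpoly.Separable) :
    ∃ a : Matrix (Fin m) (Fin m) F → (Fin m → F),
      ContinuousOn a {t | Commute t γ ∧ t.charpoly.Separable} ∧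
      ∀ t, Commute t γ → t.charpoly.Separable → ∑ k : Fin m, a t k • t ^ (k : ℕ) = γ := by
  classical
  -- flattened powers
  set V : Matrix (Fin m) (Fin m) F → Matrix (Fin m × Fin m) (Fin m) F :=
    fun t => Matrix.of fun ij k => (t ^ (k : ℕ)) ij.1 ij.2 with hV
  have hVmul : ∀ t (c : Fin m → F), V t *ᵥ c = fun ij => (∑ k : Fin m, c k • t ^ (k : ℕ)) ij.1 ij.2 := by
    intro t c
    funext ij
    simp only [hV, Matrix.mulVec, dotProduct, Matrix.of_apply, Matrix.sum_apply, Matrix.smul_apply, smul_eq_mul]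
    exact Finset.sum_congr rfl fun k _ => mul_comm _ _
  have hVinj : ∀ t : Matrix (Fin m) (Fin m) F, t.charpoly.Separable → Function.Injective (V t).mulVec := by
    intro t ht c c' h
    rw [← sub_eq_zero]
    refine eq_zero_of_sum_smul_pow_eq_zero t ht ?_
    have h' : V t *ᵥ (c - c') = 0 := by rw [Matrix.mulVec_sub, h, sub_self]
    rw [hVmul] at h'
    ext i j
    simpa using congr_fun h' (i, j)
  -- a left inverse `R` of `V γ`
  obtain ⟨g, hg⟩ := LinearMap.exists_leftInverse_of_injective (Matrix.toLin' (V γ))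
    (LinearMap.ker_eq_bot.2 fun c c' h => hVinj γ hγ (by simpa only [Matrix.toLin'_apply] using h))
  set R : Matrix (Fin m) (Fin m × Fin m) F := LinearMap.toMatrix' g with hR
  have hRV : R * V γ = 1 := by
    have h := congrArg LinearMap.toMatrix' hg
    rwa [LinearMap.toMatrix'_comp, LinearMap.toMatrix'_toLin', LinearMap.toMatrix'_id] at h
  set M : Matrix (Fin m) (Fin m) F → Matrix (Fin m) (Fin m) F := fun t => R * V t with hM
  -- `V γ * M t = V t` on the commutant
  have hVM : ∀ t, Commute t γ → V γ * M t = V t := by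
    intro t ht
    obtain ⟨Q, hQ⟩ := exists_pow_eq_sum_smul_pow_of_commute γ hγ ht
    have hVt : V t = V γ * Q := by
      ext ij k
      simp only [hV, Matrix.of_apply, Matrix.mul_apply, hQ k, Matrix.sum_apply, Matrix.smul_apply, smul_eq_mul]
      exact Finset.sum_congr rfl fun j _ => mul_comm _ _
    rw [hM]
    change V γ * (R * V t) = V t
    rw [hVt, ← Matrix.mul_assoc, ← Matrix.mul_assoc, Matrix.mul_assoc (V γ) R, hRV, Matrix.mul_one]
  -- `M t` is invertible on the regular part of the commutant
  have hMunit : ∀ t, Commute t γ → t.charpoly.Separable → IsUnit (M t).det := by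
    intro t ht hts
    rw [← Matrix.isUnit_iff_isUnit_det]
    refine Matrix.mulVec_injective_iff_isUnit.1 fun c c' h => hVinj t hts ?_
    have h2 := congrArg (fun w => V γ *ᵥ w) h
    simpa only [Matrix.mulVec_mulVec, hVM t ht] using h2
  -- `vec γ` lies in the column space of `V γ`
  obtain ⟨c₀, hc₀⟩ := exists_eq_sum_smul_pow_of_mem_adjoin γ (Algebra.self_mem_adjoin_singleton F γ)
  have hvec : (fun ij : Fin m × Fin m => γ ij.1 ij.2) = V γ *ᵥ c₀ := by
    rw [hVmul]; funext ij; rw [← hc₀]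
  -- the coefficient map
  refine ⟨fun t => (M t)⁻¹ *ᵥ (R *ᵥ fun ij : Fin m × Fin m => γ ij.1 ij.2), ?_, ?_⟩
  · -- continuity on the regular part of the commutant
    have hVc : Continuous V :=
      continuous_matrix fun ij k => (continuous_id.pow (k : ℕ)).matrix_elem ij.1 ij.2
    have hMc : Continuous M := continuous_const.matrix_mul hVc
    have hdet : ContinuousOn (fun t => Ring.inverse (M t).det) {t | Commute t γ ∧ t.charpoly.Separable} := by
      rw [Ring.inverse_eq_inv']
      exact hMc.matrix_det.continuousOn.inv₀ fun t ht => (hMunit t ht.1 ht.2).ne_zero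
    have h3 : Continuous fun p : F × Matrix (Fin m) (Fin m) F =>
        (p.1 • p.2.adjugate) *ᵥ (R *ᵥ fun ij : Fin m × Fin m => γ ij.1 ij.2) :=
      (continuous_fst.smul continuous_snd.matrix_adjugate).matrix_mulVec continuous_const
    have h4 := h3.comp_continuousOn (hdet.prodMk hMc.continuousOn)
    refine h4.congr fun t _ => ?_
    simp only [Function.comp_apply, Matrix.inv_def]
  · intro t ht hts
    have hflat : V t *ᵥ ((M t)⁻¹ *ᵥ (R *ᵥ fun ij : Fin m × Fin m => γ ij.1 ij.2)) = fun ij : Fin m × Fin m => γ ij.1 ij.2 := by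
      calc V t *ᵥ ((M t)⁻¹ *ᵥ (R *ᵥ fun ij : Fin m × Fin m => γ ij.1 ij.2))
          = (V γ * M t) *ᵥ ((M t)⁻¹ *ᵥ (R *ᵥ fun ij : Fin m × Fin m => γ ij.1 ij.2)) := by rw [hVM t ht]
        _ = V γ *ᵥ ((M t * (M t)⁻¹) *ᵥ (R *ᵥ fun ij : Fin m × Fin m => γ ij.1 ij.2)) := by
          simp only [← Matrix.mulVec_mulVec]
        _ = V γ *ᵥ (R *ᵥ (V γ *ᵥ c₀)) := by rw [Matrix.mul_nonsing_inv _ (hMunit t ht hts), Matrix.one_mulVec, hvec]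
        _ = (V γ * (R * V γ)) *ᵥ c₀ := by simp only [← Matrix.mulVec_mulVec]
        _ = fun ij : Fin m × Fin m => γ ij.1 ij.2 := by rw [hRV, Matrix.mul_one, hvec]
    rw [hVmul] at hflat
    ext i j
    exact congr_fun hflat (i, j)

omit [TopologicalSpace F] [IsTopologicalRing F] [ContinuousInv₀ F] in
/-- Conjugation commutes with the straightening: `x (Σ_k a_k t^k) x⁻¹ = Σ_k a_k (x t x⁻¹)^k`. [cite: HarishChandra1970, Part I §3 Lemma 13] -/
theorem units_conj_sum_smul_pow (x : GL (Fin m) F) (t : Matrix (Fin m) (Fin m) F) (a : Fin m → F) :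
    (x : Matrix (Fin m) (Fin m) F) * (∑ k : Fin m, a k • t ^ (k : ℕ)) * (x⁻¹ : GL (Fin m) F) =
      ∑ k : Fin m, a k • ((x : Matrix (Fin m) (Fin m) F) * t * (x⁻¹ : GL (Fin m) F)) ^ (k : ℕ) := by
  rw [Finset.mul_sum, Finset.sum_mul]
  refine Finset.sum_congr rfl fun k _ => ?_
  rw [Matrix.mul_smul, Matrix.smul_mul, Units.conj_pow]

end Straighten

/-! ## §3 `GL_m(F)` over a topological field -/

section GeneralLinear

variable {F : Type*} [Field F] {m : ℕ}

/-- The commutant of a regular semisimple matrix is commutative: if `t` and `τ` both commute with `γ` (separable characteristic polynomial)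
then they commute with each other (`t ∈ F[γ]`). [cite: HornJohnson2013, Thm. 3.2.4.2] -/
theorem commute_of_commute_of_charpoly_separable (γ : Matrix (Fin m) (Fin m) F) (hγ : γ.charpoly.Separable)
    {t τ : Matrix (Fin m) (Fin m) F} (ht : Commute t γ) (hτ : Commute τ γ) : Commute τ t := by
  obtain ⟨p, -, htp⟩ := exists_eq_aeval_of_commute_of_minpoly_eq_charpoly γ t (minpoly_eq_charpoly_of_charpoly_separable γ hγ) ht.symm
  obtain ⟨c, hc⟩ := exists_eq_sum_smul_pow_of_mem_adjoin γ (x := t) (by rw [htp]; exact Polynomial.aeval_mem_adjoin_singleton F γ)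
  rw [hc]
  exact Commute.sum_right _ _ _ fun k _ => (hτ.pow_right (k : ℕ)).smul_right (c k)

/-- Units version: in `GL_m(F)` the centraliser of a regular semisimple `γ` centralises each of its own elements.
[cite: HornJohnson2013, Thm. 3.2.4.2] -/
theorem GL.mul_eq_mul_of_mem_centralizer_of_charpoly_separable (γ : GL (Fin m) F)
    (hγ : (γ : Matrix (Fin m) (Fin m) F).charpoly.Separable) {t τ : GL (Fin m) F}
    (ht : t ∈ Subgroup.centralizer ({γ} : Set (GL (Fin m) F))) (hτ : τ ∈ Subgroup.centralizer ({γ} : Set (GL (Fin m) F))) :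
    τ * t = t * τ := by
  have ht' : Commute (t : Matrix (Fin m) (Fin m) F) γ := by
    have h := congrArg Units.val (Subgroup.mem_centralizer_singleton_iff.1 ht)
    rw [Units.val_mul, Units.val_mul] at h
    exact h
  have hτ' : Commute (τ : Matrix (Fin m) (Fin m) F) γ := by
    have h := congrArg Units.val (Subgroup.mem_centralizer_singleton_iff.1 hτ)
    rw [Units.val_mul, Units.val_mul] at h
    exact h
  exact Units.ext (by simpa only [Units.val_mul] using (commute_of_commute_of_charpoly_separable _ hγ ht' hτ').eq)

variable [TopologicalSpace F] [IsTopologicalRing F] [ContinuousInv₀ F] [T1Space F]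

/-- **The compact `D`.**  For `γ ∈ GL_m(F)` regular semisimple, `K ⊆ GL_m(F)` compact consisting of regular elements commuting with `γ`, and
`C` compact, there is ONE compact `D ⊆ GL_m(F)` with `x t x⁻¹ ∈ C ⇒ x γ x⁻¹ ∈ D` for all `t ∈ K` and all `x`
(`D` = the units over `p(K × C) ∩ {charpoly = charpoly γ}`, on which `g⁻¹ = (det γ)⁻¹ adj g` is continuous). [cite: HarishChandra1970, Part I §3 Lemmas 13–14] -/
theorem GL.exists_isCompact_forall_conj_mem_of_charpoly_separable (γ : GL (Fin m) F)
    (hγ : (γ : Matrix (Fin m) (Fin m) F).charpoly.Separable) {K C : Set (GL (Fin m) F)} (hK : IsCompact K)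
    (hKc : ∀ t ∈ K, Commute (t : Matrix (Fin m) (Fin m) F) γ) (hKreg : ∀ t ∈ K, (t : Matrix (Fin m) (Fin m) F).charpoly.Separable)
    (hC : IsCompact C) :
    ∃ D : Set (GL (Fin m) F), IsCompact D ∧ ∀ t ∈ K, ∀ x : GL (Fin m) F, x * t * x⁻¹ ∈ C → x * γ * x⁻¹ ∈ D := by
  classical
  obtain ⟨a, ha, hsum⟩ := exists_continuousOn_sum_smul_pow_eq_of_charpoly_separable (γ : Matrix (Fin m) (Fin m) F) hγ
  -- the straightening map on matrices and its compact image
  set str : Matrix (Fin m) (Fin m) F × Matrix (Fin m) (Fin m) F → Matrix (Fin m) (Fin m) F :=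
    fun q => ∑ k : Fin m, a q.1 k • q.2 ^ (k : ℕ) with hstr
  set K' : Set (Matrix (Fin m) (Fin m) F) := ((↑) : GL (Fin m) F → Matrix (Fin m) (Fin m) F) '' K with hK'
  set C' : Set (Matrix (Fin m) (Fin m) F) := ((↑) : GL (Fin m) F → Matrix (Fin m) (Fin m) F) '' C with hC'
  have hK'c : IsCompact K' := hK.image Units.continuous_val
  have hC'c : IsCompact C' := hC.image Units.continuous_val
  have hK'sub : K' ⊆ {t | Commute t (γ : Matrix (Fin m) (Fin m) F) ∧ t.charpoly.Separable} := by
    rintro _ ⟨t, ht, rfl⟩; exact ⟨hKc t ht, hKreg t ht⟩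
  have hstrc : ContinuousOn str (K' ×ˢ C') := by
    refine continuousOn_finsetSum _ fun k _ => ?_
    have h1 : ContinuousOn (fun q : Matrix (Fin m) (Fin m) F × Matrix (Fin m) (Fin m) F => a q.1 k) (K' ×ˢ C') :=
      ((continuous_apply k).comp_continuousOn ha).comp continuousOn_fst fun q hq => hK'sub (mem_prod.1 hq).1
    exact h1.smul ((continuous_snd.pow (k : ℕ)).continuousOn)
  set P : Set (Matrix (Fin m) (Fin m) F) :=
    str '' (K' ×ˢ C') ∩ {W | W.charpoly = (γ : Matrix (Fin m) (Fin m) F).charpoly} with hP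
  have hPc : IsCompact P := ((hK'c.prod hC'c).image_of_continuousOn hstrc).inter_right (isClosed_setOf_charpoly_eq _)
  -- on `P` the determinant is `det γ`, so `W ↦ (W, (det γ)⁻¹ adj W)` parametrises the units over `P` continuously
  have hdetP : ∀ W ∈ P, W.det = (γ : Matrix (Fin m) (Fin m) F).det := fun W hW => by
    rw [Matrix.det_eq_sign_charpoly_coeff, Matrix.det_eq_sign_charpoly_coeff, hW.2]
  have hdγ : IsUnit (γ : Matrix (Fin m) (Fin m) F).det := (Matrix.isUnit_iff_isUnit_det _).1 (Units.isUnit γ)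
  haveI : CompactSpace P := isCompact_iff_compactSpace.1 hPc
  have hWunit : ∀ W : P, IsUnit (W : Matrix (Fin m) (Fin m) F).det := fun W => by rw [hdetP W W.2]; exact hdγ
  set φ : P → GL (Fin m) F := fun W => (W : Matrix (Fin m) (Fin m) F).nonsingInvUnit (hWunit W) with hφ_def
  have hφval : ∀ W : P, ((φ W : GL (Fin m) F) : Matrix (Fin m) (Fin m) F) = W := fun W => rfl
  have hφc : Continuous φ := by
    refine Units.continuous_iff.2 ⟨?_, ?_⟩
    · show Continuous fun W : P => (W : Matrix (Fin m) (Fin m) F)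
      exact continuous_subtype_val
    have h : (fun W : P => ((φ W)⁻¹ : GL (Fin m) F).val) =
        fun W : P => Ring.inverse (γ : Matrix (Fin m) (Fin m) F).det • (W : Matrix (Fin m) (Fin m) F).adjugate := by
      funext W
      rw [Matrix.coe_units_inv, hφval, Matrix.inv_def, hdetP W W.2]
    rw [h]
    exact (continuous_const : Continuous fun _ : P => Ring.inverse (γ : Matrix (Fin m) (Fin m) F).det).smul
      ((continuous_subtype_val : Continuous fun W : P => (W : Matrix (Fin m) (Fin m) F)).matrix_adjugate)
  refine ⟨Set.range φ, isCompact_range hφc, fun t ht x hx => ?_⟩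
  -- `x γ x⁻¹ = p(t, x t x⁻¹)` has the characteristic polynomial of `γ`
  have hval : ((x * γ * x⁻¹ : GL (Fin m) F) : Matrix (Fin m) (Fin m) F) =
      str ((t : Matrix (Fin m) (Fin m) F), ((x * t * x⁻¹ : GL (Fin m) F) : Matrix (Fin m) (Fin m) F)) := by
    simp only [hstr, Units.val_mul]
    rw [← units_conj_sum_smul_pow, hsum _ (hKc t ht) (hKreg t ht)]
  have hmem : ((x * γ * x⁻¹ : GL (Fin m) F) : Matrix (Fin m) (Fin m) F) ∈ P := by
    refine ⟨⟨(↑t, ↑(x * t * x⁻¹)), mem_prod.2 ⟨⟨t, ht, rfl⟩, ⟨_, hx, rfl⟩⟩, hval.symm⟩, ?_⟩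
    simp only [mem_setOf_eq, Units.val_mul, Matrix.coe_units_inv, Matrix.charpoly_units_conj]
  exact ⟨⟨_, hmem⟩, Units.ext (hφval _)⟩

/-- **HARISH-CHANDRA'S UNIFORM COMPACTNESS IN `GL_m(F)`** (`F` a topological field with continuous inversion and closed points, `GL_m(F)` σ-compact,
locally compact, Hausdorff — e.g. a non-archimedean local field).  For `γ` regular semisimple with centraliser `T = Z(γ)`, a compact `K ⊆ T` of
regular elements and a compact `C`: `{ẋ ∈ GL_m(F) ⧸ T ∣ ∃ t ∈ K, x t x⁻¹ ∈ C}` is COMPACT. [cite: HarishChandra1970, Part I §3 Lemma 14]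
[cite: Rogawski1990, §4.9 p. 54] [cite: DeitmarEchterhoff2014, Lemma 9.3.3] -/
theorem GL.isCompact_image_mk_setOf_exists_conj_mem_of_charpoly_separable
    [SigmaCompactSpace (GL (Fin m) F)] [LocallyCompactSpace (GL (Fin m) F)] [T2Space (GL (Fin m) F)]
    (γ : GL (Fin m) F) (hγ : (γ : Matrix (Fin m) (Fin m) F).charpoly.Separable) {K C : Set (GL (Fin m) F)}
    (hK : IsCompact K) (hKZ : K ⊆ Subgroup.centralizer ({γ} : Set (GL (Fin m) F)))
    (hKreg : ∀ t ∈ K, (t : Matrix (Fin m) (Fin m) F).charpoly.Separable) (hC : IsCompact C) :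
    IsCompact ((QuotientGroup.mk : GL (Fin m) F → GL (Fin m) F ⧸ Subgroup.centralizer ({γ} : Set (GL (Fin m) F))) ''
      {x | ∃ t ∈ K, x * t * x⁻¹ ∈ C}) := by
  have hKc : ∀ t ∈ K, Commute (t : Matrix (Fin m) (Fin m) F) γ := fun t ht => by
    have h := congrArg Units.val (Subgroup.mem_centralizer_singleton_iff.1 (hKZ ht))
    rw [Units.val_mul, Units.val_mul] at h
    exact h
  obtain ⟨D, hD, hstr⟩ := GL.exists_isCompact_forall_conj_mem_of_charpoly_separable γ hγ hK hKc hKreg hC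
  exact isCompact_image_mk_setOf_exists_conj_mem (Subgroup.centralizer ({γ} : Set (GL (Fin m) F))) γ
    (fun _ hg => Subgroup.mem_centralizer_singleton_iff.1 hg)
    (fun D hD => isCompact_preimage_descConj_id_of_isClosed γ (isClosed_conjClass_of_charpoly_separable_field γ hγ) hD)
    hK (fun t ht τ hτ => GL.mul_eq_mul_of_mem_centralizer_of_charpoly_separable γ hγ (hKZ ht) hτ) hC.isClosed hD hstr

/-- The `∃`-form the orbital-integral consumers read: ONE compact `E ⊆ GL_m(F) ⧸ Z(γ)` carrying the support of every orbital integrand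
`ẋ ↦ f(x t x⁻¹)`, `t ∈ K`, of every `f` supported in `C`. [cite: Rogawski1990, §4.9 p. 54] [cite: HarishChandra1970, Part I §3 Lemma 14] -/
theorem GL.exists_isCompact_forall_support_descConj_subset_of_charpoly_separable
    [SigmaCompactSpace (GL (Fin m) F)] [LocallyCompactSpace (GL (Fin m) F)] [T2Space (GL (Fin m) F)]
    (γ : GL (Fin m) F) (hγ : (γ : Matrix (Fin m) (Fin m) F).charpoly.Separable) {K C : Set (GL (Fin m) F)}
    (hK : IsCompact K) (hKZ : K ⊆ Subgroup.centralizer ({γ} : Set (GL (Fin m) F)))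
    (hKreg : ∀ t ∈ K, (t : Matrix (Fin m) (Fin m) F).charpoly.Separable) (hC : IsCompact C) :
    ∃ E : Set (GL (Fin m) F ⧸ Subgroup.centralizer ({γ} : Set (GL (Fin m) F))), IsCompact E ∧
      ∀ {β : Type*} [Zero β] (f : GL (Fin m) F → β), Function.support f ⊆ C → ∀ t (ht : t ∈ K),
        Function.support (descConj t (Subgroup.centralizer ({γ} : Set (GL (Fin m) F)))
          (fun _ hτ => GL.mul_eq_mul_of_mem_centralizer_of_charpoly_separable γ hγ (hKZ ht) hτ) f) ⊆ E :=
  ⟨_, GL.isCompact_image_mk_setOf_exists_conj_mem_of_charpoly_separable γ hγ hK hKZ hKreg hC,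
    fun _ hf _ ht => support_descConj_subset_of_subset _
      (fun _ ht _ hτ => GL.mul_eq_mul_of_mem_centralizer_of_charpoly_separable γ hγ (hKZ ht) hτ) subset_rfl hf ht⟩

end GeneralLinear

/-! ## §4 The unitary group `U(σ, J)(E) ≤ GL_m(E)` of a form over a complete field -/

section Unitary

variable {E : Type*} [NontriviallyNormedField E] [CompleteSpace E] {m : ℕ}

/-- **HARISH-CHANDRA'S UNIFORM COMPACTNESS IN `U(σ, J)(E)`** (`E` a complete nontrivially normed field with `2 ≠ 0`, `σ` a continuous
involution, `J` `σ`-hermitian with unit determinant, `GL_m(E)` σ-compact, locally compact, Hausdorff — the non-archimedean unitary groups of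
[Rogawski1990] at a non-split place in the currency of ★ `RegularOrbitChartUnitary`).  For `γ ∈ U(σ, J)` regular semisimple with centraliser
`T_U = Z_U(γ)`, a compact `K ⊆ T_U` of regular elements and a compact `C ⊆ U(σ, J)`: `{ẋ ∈ U ⧸ T_U ∣ ∃ t ∈ K, x t x⁻¹ ∈ C}` is COMPACT.
[cite: HarishChandra1970, Part I §3 Lemma 14] [cite: Rogawski1990, §4.9 p. 54; §3.1 p. 19] [cite: DeitmarEchterhoff2014, Lemma 9.3.3] -/
theorem UnitaryGroupOfForm.isCompact_image_mk_setOf_exists_conj_mem_of_charpoly_separable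
    [SigmaCompactSpace (GL (Fin m) E)] [LocallyCompactSpace (GL (Fin m) E)] [T2Space (GL (Fin m) E)]
    (h2 : (2 : E) ≠ 0) {σ : E →+* E} (hσc : Continuous σ) (hσ : ∀ x, σ (σ x) = x) {J : Matrix (Fin m) (Fin m) E}
    (hJ : (J.map σ)ᵀ = J) (hJu : IsUnit J.det) (γ : ↥(unitaryGroupOfForm σ J))
    (hγ : ((γ : GL (Fin m) E) : Matrix (Fin m) (Fin m) E).charpoly.Separable) {K C : Set ↥(unitaryGroupOfForm σ J)}
    (hK : IsCompact K) (hKZ : K ⊆ Subgroup.centralizer ({γ} : Set ↥(unitaryGroupOfForm σ J)))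
    (hKreg : ∀ t ∈ K, ((t : GL (Fin m) E) : Matrix (Fin m) (Fin m) E).charpoly.Separable) (hC : IsCompact C) :
    IsCompact ((QuotientGroup.mk : ↥(unitaryGroupOfForm σ J) →
        ↥(unitaryGroupOfForm σ J) ⧸ Subgroup.centralizer ({γ} : Set ↥(unitaryGroupOfForm σ J))) ''
      {x | ∃ t ∈ K, x * t * x⁻¹ ∈ C}) := by
  have hUc := isClosed_unitaryGroupOfForm (n := Fin m) hσc J
  haveI : SigmaCompactSpace ↥(unitaryGroupOfForm σ J) := hUc.sigmaCompactSpace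
  haveI : LocallyCompactSpace ↥(unitaryGroupOfForm σ J) := locallyCompactSpace_unitaryGroupOfForm hσc J
  -- the single-element input: the `U(σ, J)`-class of `γ` is closed (★), so its orbit map is proper (★)
  have hO := isClosed_conjClass_unitaryGroupOfForm_of_isClosed σ J hσc hσ hJ hJu
    (Literature.Analysis.Calculus.exists_isOpen_injOn_mul_self_matrix_nhds h2) γ
    (isClosed_conjClass_of_charpoly_separable_field (γ : GL (Fin m) E) hγ)
  -- the compact `D` at the `GL` level, pulled back along the closed embedding `U ↪ GL`
  have hKc : ∀ t ∈ ((↑) : ↥(unitaryGroupOfForm σ J) → GL (Fin m) E) '' K, Commute (t : Matrix (Fin m) (Fin m) E) (γ : GL (Fin m) E) := by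
    rintro _ ⟨t, ht, rfl⟩
    have h := congrArg (fun u : ↥(unitaryGroupOfForm σ J) => ((u : GL (Fin m) E) : Matrix (Fin m) (Fin m) E))
      (Subgroup.mem_centralizer_singleton_iff.1 (hKZ ht))
    simp only [Subgroup.coe_mul, Units.val_mul] at h
    exact h
  have hKreg' : ∀ t ∈ ((↑) : ↥(unitaryGroupOfForm σ J) → GL (Fin m) E) '' K, (t : Matrix (Fin m) (Fin m) E).charpoly.Separable := by
    rintro _ ⟨t, ht, rfl⟩; exact hKreg t ht
  obtain ⟨D, hD, hstr⟩ := GL.exists_isCompact_forall_conj_mem_of_charpoly_separable (γ : GL (Fin m) E) hγ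
    (hK.image continuous_subtype_val) hKc hKreg' (hC.image continuous_subtype_val)
  have hKT : ∀ t ∈ K, ∀ τ ∈ Subgroup.centralizer ({γ} : Set ↥(unitaryGroupOfForm σ J)), τ * t = t * τ := by
    intro t ht τ hτ
    have ht' : (t : GL (Fin m) E) ∈ Subgroup.centralizer ({(γ : GL (Fin m) E)} : Set (GL (Fin m) E)) := by
      rw [Subgroup.mem_centralizer_singleton_iff, ← Subgroup.coe_mul, ← Subgroup.coe_mul,
        Subgroup.mem_centralizer_singleton_iff.1 (hKZ ht)]
    have hτ' : (τ : GL (Fin m) E) ∈ Subgroup.centralizer ({(γ : GL (Fin m) E)} : Set (GL (Fin m) E)) := by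
      rw [Subgroup.mem_centralizer_singleton_iff, ← Subgroup.coe_mul, ← Subgroup.coe_mul,
        Subgroup.mem_centralizer_singleton_iff.1 hτ]
    exact Subtype.ext (GL.mul_eq_mul_of_mem_centralizer_of_charpoly_separable (γ : GL (Fin m) E) hγ ht' hτ')
  refine isCompact_image_mk_setOf_exists_conj_mem (Subgroup.centralizer ({γ} : Set ↥(unitaryGroupOfForm σ J))) γ
    (fun _ hg => Subgroup.mem_centralizer_singleton_iff.1 hg)
    (fun D hD => isCompact_preimage_descConj_id_of_isClosed γ hO hD) hK hKT hC.isClosed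
    (hUc.isClosedEmbedding_subtypeVal.isCompact_preimage hD) fun t ht x hx => ?_
  refine hstr _ ⟨t, ht, rfl⟩ (x : GL (Fin m) E) ⟨_, hx, ?_⟩
  simp only [Subgroup.coe_mul, Subgroup.coe_inv]

/-- The `∃`-form for `U(σ, J)(E)`: ONE compact `E ⊆ U ⧸ Z_U(γ)` carrying the support of every orbital integrand `ẋ ↦ f(x t x⁻¹)`, `t ∈ K`, of
every `f` supported in `C` — the socket of the non-split local constancy ∕ smoothness of regular orbital integrals and of the H-side
surjectivity. [cite: Rogawski1990, §4.9 p. 54] [cite: HarishChandra1970, Part I §3 Lemma 14] -/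
theorem UnitaryGroupOfForm.exists_isCompact_forall_support_descConj_subset_of_charpoly_separable
    [SigmaCompactSpace (GL (Fin m) E)] [LocallyCompactSpace (GL (Fin m) E)] [T2Space (GL (Fin m) E)]
    (h2 : (2 : E) ≠ 0) {σ : E →+* E} (hσc : Continuous σ) (hσ : ∀ x, σ (σ x) = x) {J : Matrix (Fin m) (Fin m) E}
    (hJ : (J.map σ)ᵀ = J) (hJu : IsUnit J.det) (γ : ↥(unitaryGroupOfForm σ J))
    (hγ : ((γ : GL (Fin m) E) : Matrix (Fin m) (Fin m) E).charpoly.Separable) {K C : Set ↥(unitaryGroupOfForm σ J)}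
    (hK : IsCompact K) (hKZ : K ⊆ Subgroup.centralizer ({γ} : Set ↥(unitaryGroupOfForm σ J)))
    (hKreg : ∀ t ∈ K, ((t : GL (Fin m) E) : Matrix (Fin m) (Fin m) E).charpoly.Separable) (hC : IsCompact C)
    (hKT : ∀ t ∈ K, ∀ τ ∈ Subgroup.centralizer ({γ} : Set ↥(unitaryGroupOfForm σ J)), τ * t = t * τ) :
    ∃ S : Set (↥(unitaryGroupOfForm σ J) ⧸ Subgroup.centralizer ({γ} : Set ↥(unitaryGroupOfForm σ J))), IsCompact S ∧
      ∀ {β : Type*} [Zero β] (f : ↥(unitaryGroupOfForm σ J) → β), Function.support f ⊆ C → ∀ t (ht : t ∈ K),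
        Function.support (descConj t (Subgroup.centralizer ({γ} : Set ↥(unitaryGroupOfForm σ J))) (hKT t ht) f) ⊆ S :=
  ⟨_, UnitaryGroupOfForm.isCompact_image_mk_setOf_exists_conj_mem_of_charpoly_separable h2 hσc hσ hJ hJu γ hγ hK hKZ hKreg hC,
    fun _ hf _ ht => support_descConj_subset_of_subset _ hKT subset_rfl hf ht⟩

end Unitary

end Literature.NumberTheory.Automorphic

end
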